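import Mathlib.Combinatorics.Additive.AP.Three.Behrend
import Literature.NumberTheory.Transcendental.DiazConstruction
import Literature.NumberTheory.Transcendental.DiazMain
import HarnessLib

/-!
# The interpolation points `μ.v` of Diaz 1989: counting, size, separation, product bound

Topic `Literature/NumberTheory/Transcendental` (trunk T-TRANSCEND). Decomposition step for the
named fact `Literature.NumberTheory.Transcendental.Diaz1989_thm1` (`DiazMain.lean`). In §II-3-2 (c) of G. Diaz,
J. Number Theory 31 (1989), pp. 9–11, the auxiliary function is extrapolated from the set
`𝓔(M) = {μ.v ; μ ∈ ℕ^m, |μ| < M}` (`μ.v = ∑ μ_kv_k`), and the interpolation formula needs: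
the number of points (`M^m`), their size (`≤ r`), and a lower bound for the products
`∏_{e' ≠ e} |e - e'|` over `𝓔(M)`, which the source takes from Reyssat's Lemme 4.5 in the shape
`(|v_m|/(2δ(M)))^{M^{m-1}} (…)^{M^m}`, `δ(M)` a lower bound for the mutual distances (from the
technical hypothesis (HT1)(b): `δ(M) = exp(-M log M)`, p. 11). The point of the exponent `M^{m-1}`
(and not `M^m`) on `1/δ(M)` is that along the last coordinate the points lie in arithmetic
progressions of difference `v_m`, in which at most one point is close to a given one.

We prove exactly this, with explicit constants (everything here is proved):

* the box `ℕ^m(M) = [0, M)^m` is Mathlib's `Behrend.box m M`; `pts v M = 𝓔(M)` (points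
  `μ.v = DiazThm1.muv v μ`, `DiazConstruction.lean`); `separated_of_measureB` — (HT1)(b) gives
  `Separated v M (exp(-min(M log M, M^η)))` for `M` large;
* `Separated v M δ` — `|ν.v| ≥ δ` for nonzero `ν ∈ ℤ^m` with `|ν_k| < M` (supplied by (HT1)(b));
* `card_pts : #𝓔(M) = M^m`, `norm_muv_le_of_mem_box : |μ.v| ≤ M ∑|v_k|`, `le_norm_muv_sub_muv : |μ.v - μ'.v| ≥ δ`;
* `prod_norm_sub_ge` : for `m = m'+1`, `δ ≤ 1`, `ω = min(1, |v_m|/2)` and `e ∈ 𝓔(M)`,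
  `∏_{e' ∈ 𝓔(M) ∖ {e}} |e - e'| ≥ (δ ω^M)^{M^{m'}}`.

## References

* G. Diaz, *Grands degrés de transcendance pour des familles d'exponentielles*, J. Number Theory
  31 (1989), 1–23, §II-3-2 (c), pp. 9–11.
-/

noncomputable section

open Finset

namespace Literature.NumberTheory.Transcendental

namespace DiazThm1

variable {m : ℕ}

/-- The interpolation set `𝓔(M) = {μ.v ; μ ∈ ℕ^m(M)}`. [cite: Diaz1989, §II-3-2 (c) p. 9] -/
def pts (v : Fin m → ℂ) (M : ℕ) : Finset ℂ := (Behrend.box m M).image (muv v)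

/-- Separation of the points: every nonzero `ν ∈ ℤ^m` with `|ν_k| < M` has `|ν.v| ≥ δ` (in the
source, `δ(M) = exp(-M log M)` from (HT1)(b), p. 11). [cite: Diaz1989, §II-3-2 p. 11 (δ(M))] -/
def Separated (v : Fin m → ℂ) (M : ℕ) (δ : ℝ) : Prop :=
  ∀ ν : Fin m → ℤ, ν ≠ 0 → (∀ k, |ν k| < M) → δ ≤ ‖∑ k, (ν k : ℂ) * v k‖

/-- **(HT1)(b) supplies the separation**: if `v` satisfies Diaz's measure (b) with exponent `η`,
then for every `M > X(v)` the points of `ℕ^m(M)` are separated by `δ(M) = exp(-min(M log M, M^η))`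
(Diaz 1989, p. 11: "on sait que `|μ.v| ≥ exp(-M log M)` pour tout `μ ∈ ℤ^m` non nul tel que
`|μ| < M`"). [cite: Diaz1989, §II-3-2 p. 11 (δ(M))] -/
theorem separated_of_measureB {v : Fin m → ℂ} {η : ℝ} (h : Diaz1989.MeasureB v η) :
    ∃ X₀ : ℝ, 0 < X₀ ∧ ∀ M : ℕ, X₀ < M →
      Separated v M (Real.exp (-(min ((M : ℝ) * Real.log M) ((M : ℝ) ^ η)))) := by
  obtain ⟨X₀, hX₀, hb⟩ := h
  refine ⟨X₀, hX₀, fun M hM ν hν hνM => hb ν hν M hM fun k => ?_⟩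
  exact_mod_cast (hνM k).le

/-- Differences of points: `μ.v - μ'.v = (μ - μ').v`. [folklore] -/
theorem muv_sub_muv (v : Fin m → ℂ) (μ μ' : Fin m → ℕ) :
    muv v μ - muv v μ' = ∑ k, (((μ k : ℤ) - μ' k : ℤ) : ℂ) * v k := by
  unfold muv
  rw [← Finset.sum_sub_distrib]
  refine Finset.sum_congr rfl fun k _ => ?_
  push_cast
  ring

/-- Separated points are at mutual distance `≥ δ`. [folklore] -/
theorem le_norm_muv_sub_muv {v : Fin m → ℂ} {M : ℕ} {δ : ℝ} (h : Separated v M δ)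
    {μ μ' : Fin m → ℕ} (hμ : μ ∈ Behrend.box m M) (hμ' : μ' ∈ Behrend.box m M) (hne : μ ≠ μ') :
    δ ≤ ‖muv v μ - muv v μ'‖ := by
  rw [muv_sub_muv]
  refine h _ ?_ fun k => ?_
  · intro h0
    apply hne
    funext k
    have := congrFun h0 k
    simp only [Pi.zero_apply, sub_eq_zero] at this
    exact_mod_cast this
  · have h1 := Behrend.mem_box.mp hμ k
    have h2 := Behrend.mem_box.mp hμ' k
    rw [abs_lt]
    constructor <;> omega

/-- With a positive separation, `μ ↦ μ.v` is injective on the box. [folklore] -/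
theorem injOn_muv {v : Fin m → ℂ} {M : ℕ} {δ : ℝ} (h : Separated v M δ) (hδ : 0 < δ) :
    Set.InjOn (muv v) (Behrend.box m M : Set (Fin m → ℕ)) := by
  intro μ hμ μ' hμ' heq
  by_contra hne
  have := le_norm_muv_sub_muv h (mem_coe.mp hμ) (mem_coe.mp hμ') hne
  rw [heq, sub_self, norm_zero] at this
  exact absurd this (not_le.mpr hδ)

/-- `#𝓔(M) = M^m` for separated points. [cite: Diaz1989, §II-3-2 (c) p. 10 (M^m points)] -/
theorem card_pts {v : Fin m → ℂ} {M : ℕ} {δ : ℝ} (h : Separated v M δ) (hδ : 0 < δ) :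
    (pts v M).card = M ^ m := by
  rw [pts, card_image_of_injOn (injOn_muv h hδ), Behrend.card_box]

/-- Size of the points: `|μ.v| ≤ M ∑ |v_k|` on the box. [folklore] -/
theorem norm_muv_le_of_mem_box (v : Fin m → ℂ) {M : ℕ} {μ : Fin m → ℕ} (hμ : μ ∈ Behrend.box m M) :
    ‖muv v μ‖ ≤ M * ∑ k, ‖v k‖ := by
  unfold muv
  calc ‖∑ k, (μ k : ℂ) * v k‖ ≤ ∑ k, ‖(μ k : ℂ) * v k‖ := norm_sum_le _ _
    _ ≤ ∑ k, (M : ℝ) * ‖v k‖ := by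
        refine Finset.sum_le_sum fun k _ => ?_
        rw [norm_mul]
        refine mul_le_mul_of_nonneg_right ?_ (norm_nonneg _)
        have : (μ k : ℝ) ≤ M := by exact_mod_cast (Behrend.mem_box.mp hμ k).le
        simpa using this
    _ = M * ∑ k, ‖v k‖ := by rw [Finset.mul_sum]

/-- All points of `𝓔(M)` have modulus `≤ M ∑|v_k|`. [folklore] -/
theorem norm_le_of_mem_pts (v : Fin m → ℂ) {M : ℕ} {e : ℂ} (he : e ∈ pts v M) :
    ‖e‖ ≤ M * ∑ k, ‖v k‖ := by
  obtain ⟨μ, hμ, rfl⟩ := mem_image.mp he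
  exact norm_muv_le_of_mem_box v hμ

/-- A separated family (`M ≥ 2`) has a last coordinate of modulus `≥ δ` (take `ν = e_m`); this
gives `ω = min(1, |v_m|/2) > 0` downstream. [folklore] -/
theorem le_norm_last_of_separated {m' M : ℕ} {v : Fin (m' + 1) → ℂ} {δ : ℝ}
    (hsep : Separated v M δ) (hM2 : 2 ≤ M) : δ ≤ ‖v (Fin.last m')‖ := by
  have := hsep (Pi.single (Fin.last m') 1) (by
    intro h
    have := congrFun h (Fin.last m')
    simp at this) (fun k => by
    rw [Pi.single_apply]
    split_ifs <;> simp <;> omega)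
  simpa [Pi.single_apply, Finset.sum_ite_eq'] using this

/-! ### Points on a line: the arithmetic-progression lemma -/

/-- In an arithmetic progression `c - j w` (`j ∈ J`), every term other than one of smallest
modulus has modulus `≥ |w|/2`. [folklore] -/
theorem half_norm_le_of_ne_argmin (c w : ℂ) {J : Finset ℕ} {j₀ : ℕ}
    (hmin : ∀ j ∈ J, ‖c - j₀ * w‖ ≤ ‖c - j * w‖) {j : ℕ} (hj : j ∈ J)
    (hne : j ≠ j₀) : ‖w‖ / 2 ≤ ‖c - j * w‖ := by
  have hdiff : ‖(c - j * w) - (c - j₀ * w)‖ = |(j₀ : ℝ) - j| * ‖w‖ := by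
    have : (c - j * w) - (c - j₀ * w) = ((j₀ : ℂ) - j) * w := by ring
    rw [this, norm_mul]
    congr 1
    have : ((j₀ : ℂ) - j) = (((j₀ : ℝ) - j : ℝ) : ℂ) := by push_cast; ring
    rw [this, Complex.norm_real, Real.norm_eq_abs]
  have h1 : (1 : ℝ) ≤ |(j₀ : ℝ) - j| := by
    have : (1 : ℤ) ≤ |(j₀ : ℤ) - j| := Int.one_le_abs (by omega)
    have := (Int.cast_le (R := ℝ)).mpr this
    push_cast at this
    exact this
  have h2 : ‖(c - j * w) - (c - j₀ * w)‖ ≤ ‖c - j * w‖ + ‖c - j₀ * w‖ := norm_sub_le _ _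
  have h3 := hmin j hj
  have h4 : ‖w‖ ≤ |(j₀ : ℝ) - j| * ‖w‖ := le_mul_of_one_le_left (norm_nonneg _) h1
  linarith

/-! ### The product bound -/

/-- Lower bound for a product with one distinguished factor. [folklore] -/
theorem mul_pow_le_prod {ι : Type*} [DecidableEq ι] (s : Finset ι) {i₀ : ι} (hi₀ : i₀ ∈ s)
    (f : ι → ℝ) {a b : ℝ} (ha : 0 ≤ a) (hb0 : 0 ≤ b) (hb1 : b ≤ 1)
    (h₀ : a ≤ f i₀) (h : ∀ i ∈ s, i ≠ i₀ → b ≤ f i) (N : ℕ) (hN : s.card ≤ N + 1) :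
    a * b ^ N ≤ ∏ i ∈ s, f i := by
  rw [← Finset.mul_prod_erase s f hi₀]
  have hcard : (s.erase i₀).card ≤ N := by
    rw [card_erase_of_mem hi₀]
    omega
  calc a * b ^ N ≤ a * b ^ (s.erase i₀).card :=
        mul_le_mul_of_nonneg_left (pow_le_pow_of_le_one hb0 hb1 hcard) ha
    _ = a * ∏ _i ∈ s.erase i₀, b := by rw [prod_const]
    _ ≤ f i₀ * ∏ i ∈ s.erase i₀, f i := by
        refine mul_le_mul h₀ (prod_le_prod (fun _ _ => hb0) fun i hi => ?_) ?_ ?_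
        · exact h (i) (mem_of_mem_erase hi) (ne_of_mem_erase hi)
        · exact prod_nonneg fun _ _ => hb0
        · exact ha.trans h₀

/-- The box in dimension `m'+1` is the image of `Behrend.box m' M × [0, M)` under
`(a, j) ↦ snoc a j`.
[folklore] -/
theorem box_succ_eq_image (m' M : ℕ) :
    Behrend.box (m' + 1) M = ((Behrend.box m' M) ×ˢ Finset.range M).image
      (fun p : (Fin m' → ℕ) × ℕ => Fin.snoc p.1 p.2) := by
  ext μ
  constructor
  · intro hμ
    refine mem_image.mpr ⟨(Fin.init μ, μ (Fin.last m')), ?_, ?_⟩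
    · refine mem_product.mpr ⟨Behrend.mem_box.mpr fun k => ?_, mem_range.mpr ?_⟩
      · exact Behrend.mem_box.mp hμ _
      · exact Behrend.mem_box.mp hμ _
    · exact Fin.snoc_init_self μ
  · intro hμ
    obtain ⟨⟨a, j⟩, hp, rfl⟩ := mem_image.mp hμ
    obtain ⟨ha, hj⟩ := mem_product.mp hp
    refine Behrend.mem_box.mpr fun k => ?_
    refine Fin.lastCases ?_ (fun i => ?_) k
    · simpa using mem_range.mp hj
    · simpa using Behrend.mem_box.mp ha i

/-- `(a, j) ↦ snoc a j` is injective. [folklore] -/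
theorem snoc_pair_injective (m' : ℕ) :
    Function.Injective (fun p : (Fin m' → ℕ) × ℕ => (Fin.snoc p.1 p.2 : Fin (m' + 1) → ℕ)) := by
  rintro ⟨a, j⟩ ⟨a', j'⟩ h
  have h1 : a = a' := by
    have := congrArg Fin.init h
    simpa using this
  have h2 : j = j' := by
    have := congrFun h (Fin.last m')
    simpa using this
  rw [h1, h2]

/-- `muv` of a `snoc`: `(snoc a j).v = ∑_{k<m'} a_k v_k + j v_{m'}`. [folklore] -/
theorem muv_snoc {m' : ℕ} (v : Fin (m' + 1) → ℂ) (a : Fin m' → ℕ) (j : ℕ) :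
    muv v (Fin.snoc a j) = (∑ k : Fin m', (a k : ℂ) * v (Fin.castSucc k)) + j * v (Fin.last m') := by
  unfold muv
  rw [Fin.sum_univ_castSucc]
  simp

/-- **The product bound** (the rôle of Reyssat's Lemme 4.5 in Diaz 1989, p. 10): for separated
points (`Separated v M δ`, `0 < δ ≤ 1`) in dimension `m = m'+1` and `ω = min(1, |v_{m}|/2)`, every
`μ ∈ ℕ^m(M)` satisfies `∏_{μ'' ∈ ℕ^m(M) ∖ {μ}} |μ.v - μ''.v| ≥ (δ ω^M)^{M^{m'}}`. (Along the last
coordinate the points form arithmetic progressions of difference `v_m`; in each of the `M^{m'}`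
progressions at most one point is at distance `< |v_m|/2` from `μ.v`, and that one is at distance
`≥ δ`.) Compared with the source's Reyssat-shaped bound this drops the factorial gain
`∏_{j ≠ j₀} |j - j₀| ≳ ((M-1)/e)^{M-1}` in each progression, a loss of `exp(O(M^m log M))` — the same
order as the `(1/δ(M))^{M^{m-1}}` term — which the consumer of `Λ` must (and can) budget for in `ρ`.
[cite: Diaz1989, §II-3-2 (c) p. 10 (the factor (|v_m|/(2δ(M)))^{M^{m-1}})] -/
theorem prod_box_erase_ge {m' : ℕ} (v : Fin (m' + 1) → ℂ) {M : ℕ} {δ : ℝ}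
    (hsep : Separated v M δ) (hδ : 0 < δ) (hδ1 : δ ≤ 1) {μ : Fin (m' + 1) → ℕ}
    (hμ : μ ∈ Behrend.box (m' + 1) M) :
    (δ * (min 1 (‖v (Fin.last m')‖ / 2)) ^ M) ^ (M ^ m') ≤
      ∏ μ'' ∈ (Behrend.box (m' + 1) M).erase μ, ‖muv v μ - muv v μ''‖ := by
  classical
  set w : ℂ := v (Fin.last m') with hw
  set ω : ℝ := min 1 (‖w‖ / 2) with hω
  have hω0 : 0 ≤ ω := le_min zero_le_one (by positivity)
  have hω1 : ω ≤ 1 := min_le_left _ _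
  set e : (Fin m' → ℕ) × ℕ → (Fin (m' + 1) → ℕ) := fun p => Fin.snoc p.1 p.2 with he
  have hinj : Function.Injective e := snoc_pair_injective m'
  set s : Finset ((Fin m' → ℕ) × ℕ) := (Behrend.box m' M) ×ˢ Finset.range M with hs
  have hbox : Behrend.box (m' + 1) M = s.image e := box_succ_eq_image m' M
  -- `μ = e p₀`.
  set p₀ : (Fin m' → ℕ) × ℕ := (Fin.init μ, μ (Fin.last m')) with hp₀
  have hμe : μ = e p₀ := (Fin.snoc_init_self μ).symm
  have hp₀s : p₀ ∈ s := by
    have : e p₀ ∈ s.image e := by rw [← hbox, ← hμe]; exact hμ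
    obtain ⟨p, hp, hpe⟩ := mem_image.mp this
    rwa [← hinj hpe]
  -- Rewrite the product over the box as a double product.
  rw [hbox, hμe, ← image_erase hinj, prod_image fun x _ y _ h => hinj h]
  rw [← Finset.filter_ne' s p₀, prod_filter, hs, prod_product]
  -- Bound each inner product from below by `δ ω^M`.
  have hinner : ∀ a ∈ Behrend.box m' M,
      δ * ω ^ M ≤ ∏ j ∈ Finset.range M, (if (a, j) ≠ p₀ then ‖muv v (e p₀) - muv v (e (a, j))‖ else 1) := by
    intro a ha
    -- the progression `c - j w`
    set c : ℂ := muv v (e p₀) - ∑ k : Fin m', (a k : ℂ) * v (Fin.castSucc k) with hc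
    have hterm : ∀ j : ℕ, muv v (e p₀) - muv v (e (a, j)) = c - j * w := by
      intro j
      have h1 : muv v (e (a, j)) = (∑ k : Fin m', (a k : ℂ) * v (Fin.castSucc k)) + j * w :=
        muv_snoc v a j
      rw [h1, hc, hw]
      ring
    have hMpos : 0 < M := by
      have := Behrend.mem_box.mp hμ (Fin.last m')
      omega
    have hne : (Finset.range M).Nonempty := ⟨0, mem_range.mpr hMpos⟩
    obtain ⟨j₀, hj₀, hmin⟩ := exists_min_image (Finset.range M) (fun j : ℕ => ‖c - j * w‖) hne
    refine mul_pow_le_prod (Finset.range M) hj₀ _ hδ.le hω0 hω1 ?_ ?_ M (by simp)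
    · -- the distinguished factor
      split_ifs with h
      · rw [hterm]
        rw [← hterm]
        have ha' : e (a, j₀) ∈ Behrend.box (m' + 1) M := by
          rw [hbox]; exact mem_image_of_mem _ (mem_product.mpr ⟨ha, hj₀⟩)
        have hp₀' : e p₀ ∈ Behrend.box (m' + 1) M := by rw [← hμe]; exact hμ
        exact le_norm_muv_sub_muv hsep hp₀' ha' fun heq => h (hinj heq).symm
      · exact hδ1
    · intro j hj hjne
      split_ifs with h
      · rw [hterm]
        exact (min_le_right _ _).trans (half_norm_le_of_ne_argmin c w hmin hj hjne)
      · exact hω1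
  calc (δ * ω ^ M) ^ (M ^ m') = ∏ _a ∈ Behrend.box m' M, δ * ω ^ M := by rw [prod_const, Behrend.card_box]
    _ ≤ ∏ a ∈ Behrend.box m' M, ∏ j ∈ Finset.range M,
          (if (a, j) ≠ p₀ then ‖muv v (e p₀) - muv v (e (a, j))‖ else 1) :=
        prod_le_prod (fun _ _ => by positivity) hinner

/-- The product bound on the level of the point set `𝓔(M)`: for `e ∈ 𝓔(M)`,
`∏_{e' ∈ 𝓔(M) ∖ {e}} |e - e'| ≥ (δ ω^M)^{M^{m'}}`.
[cite: Diaz1989, §II-3-2 (c) p. 10 (the factor (|v_m|/(2δ(M)))^{M^{m-1}})] -/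
theorem prod_pts_erase_ge {m' : ℕ} (v : Fin (m' + 1) → ℂ) {M : ℕ} {δ : ℝ}
    (hsep : Separated v M δ) (hδ : 0 < δ) (hδ1 : δ ≤ 1) {e : ℂ} (he : e ∈ pts v M) :
    (δ * (min 1 (‖v (Fin.last m')‖ / 2)) ^ M) ^ (M ^ m') ≤
      ∏ e' ∈ (pts v M).erase e, ‖e - e'‖ := by
  classical
  obtain ⟨μ, hμ, rfl⟩ := mem_image.mp he
  have hinj := injOn_muv hsep hδ (m := m' + 1) (M := M)
  have himg : (pts v M).erase (muv v μ) = ((Behrend.box (m' + 1) M).erase μ).image (muv v) := by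
    ext x
    simp only [pts, mem_erase, mem_image]
    constructor
    · rintro ⟨hx, μ'', hμ'', rfl⟩
      exact ⟨μ'', ⟨fun h => hx (by rw [h]), hμ''⟩, rfl⟩
    · rintro ⟨μ'', ⟨hne, hμ''⟩, rfl⟩
      exact ⟨fun h => hne (hinj (mem_coe.mpr hμ'') (mem_coe.mpr hμ) h), μ'', hμ'', rfl⟩
  rw [himg, prod_image]
  · exact prod_box_erase_ge v hsep hδ hδ1 hμ
  · intro x hx y hy h
    exact hinj (mem_coe.mpr (mem_of_mem_erase hx)) (mem_coe.mpr (mem_of_mem_erase hy)) h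

end DiazThm1

end Literature.NumberTheory.Transcendental

end
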